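import Literature.MathematicalPhysics.QuantumLattice.HubbardWave0LiebProofs
import Literature.MathematicalPhysics.QuantumLattice.HubbardModelThermodynamicLimitProofs
import Literature.MathematicalPhysics.QuantumLattice.PerronFrobeniusGroundState
import Literature.MathematicalPhysics.QuantumLattice.SectorSpectrum
import HarnessLib

/-!
# Uniqueness and positivity of the sector ground state of the Hubbard ring (Lieb–Wu 2003, §2): proofs

Family `hubbard` (trunk T-QLATTICE). This file PROVES items 1. and 2. of §2 of
E. H. Lieb, F. Y. Wu, *The one-dimensional Hubbard model: a reminiscence*, Physica A 321 (2003)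
1 = arXiv:cond-mat/0207529 — the ingredient of the identification "Bethe-ansatz state = ground
state" (node F2 of `LiebWuBetheAnsatz`) which Lieb–Wu prove there: on the ring `ℤ/Lℤ` with
hopping `T = -t < 0`, in the sector with `M` down and `M'` up electrons, `M`, `M'` odd, for every
real `U`,

1. there is only one ground state, and
2. its amplitude `f(X)` is (a constant multiple of) a strictly positive function on the region
   `R = {x₁ < ⋯ < x_M; x_{M+1} < ⋯ < x_N}` of ordered configurations,

in the case `M = M' = n` (odd) needed at half filling on the rings `N_a = 2 × odd`. The
configuration amplitude on `R` is transcribed as Lieb's coefficient matrix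
`W_{αβ} = liebW n ψ α β = σ(α, β) ψ(α↑ ∪ β↓)` of `HubbardLiebConfig` (`α`, `β` the sets of up and
down positions; `σ` absorbs the Jordan–Wigner signs of the site-major orbital order, so that
`W_{αβ}` is the amplitude of `ψ` on `∏_{x ∈ α}^{<} c†_{x↑} ∏_{x ∈ β}^{<} c†_{x↓} |0⟩`, i.e. Lieb–Wu's
`f` on `R` up to the order of the two spin species, a global sign).

## The argument (Lieb–Wu 2003, §2, pp. 4–5 of the arXiv version) and its formalisation

* *Transfer.* On coefficient matrices the Hubbard Hamiltonian acts as Lieb's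
  `𝓗 W = K W + W K + U Σ_x L_x W L_x` (`LiebThm1.liebW_hamiltonian_mulVec`), `K = liebK G t n` the
  hopping matrix of `n` spinless fermions, `L_x` the occupation of `x`. Vectorising
  (`Matrix.vec`), `𝓗` is the matrix `1 ⊗ K + Kᵀ ⊗ 1 + U Σ_x L_xᵀ ⊗ L_x` on `Config × Config`
  (`LiebWuPF.liebOp_perronFrobenius`).
* *Signs* ("all the off-diagonal terms in the Hamiltonian are non-positive (this is where we use
  the fact that `(-1)^{M-1} = (-1)^{M'-1} = 1`)"). For `t > 0` the entry of `K` for a hop across the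
  bond `{x, y}` is `-t (-1)^{#(particles strictly between x and y)}`
  (`LiebWuPF.jwSign_mul_jwSign_of_lt`); on the ring this count is `0` for `|x - y| = 1` and `n - 1`
  for the bond `{0, L-1}`, so all entries are `≤ 0` when `n` is odd
  (`LiebWuPF.re_liebK_ring_nonpos`).
* *Perron–Frobenius* (`PerronFrobeniusGroundState`: `|W|` is again a ground state by the
  variational principle, a nonnegative ground state is positive by connectedness, hence
  uniqueness). Connectedness of the hopping graph on `Config × Config` comes from Lieb's
  `reflTransGen_isHop` on the (pre)connected ring.

## Main results

* `LiebWuPF.liebOp_perronFrobenius` — matrix form: Perron–Frobenius for Lieb's `𝓗` on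
  coefficient matrices (any `K` real symmetric with nonpositive off-diagonal entries and
  connected hopping graph, `L_x` real diagonal, `U` real).
* `LiebWuPF.sector_groundState` — for any preconnected graph `G`, `t ≠ 0`, real `U` and `n` such
  that `liebK G t n` has nonpositive off-diagonal entries: sector-`(n, n)` ground states are unique
  up to scalars and have coefficient matrices of one phase, entrywise nonvanishing.
* `liebWu_sector_groundState_ring` — **Lieb–Wu 2003 §2 items 1.–2.** for the Hubbard ring
  `fermionTorusGraph 1 L`, `t > 0`, `n` odd, every real `U` (in the variational form of
  `LiebThm1.lieb_core`: `E` a lower bound of `H` on the sector and `H ψ = E ψ`).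
* `liebWu_isGroundStateInSector_ring` — the same in terms of `QLattice.IsGroundStateInSector`:
  in the sector `(N, S^z) = (2n, 0)`, `n` odd, `n ≤ L`, a ground state exists, is unique up to
  scalars, and has Lieb coefficients of one phase.

## References

* E. H. Lieb, F. Y. Wu, Physica A 321 (2003) 1–27 = arXiv:cond-mat/0207529, §2, items 1.–2.
  [LiebWuPhysicaA2003]
* E. H. Lieb, F. Y. Wu, PRL 20 (1968) 1445, eq. (3) (the first-quantised equation on which the
  argument runs); reprinted in A. Montorsi (ed.), *The Hubbard Model*, World Scientific 1992,
  pp. 63–68 (held). [LiebWuPRL1968]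
* E. H. Lieb, PRL 62 (1989) 1201, proof of Theorem 1 (the transfer `ψ ↦ W`, eq. (4)). [LiebPRL1989]
-/

namespace Literature.MathematicalPhysics.QuantumLattice

open Matrix Finset
open scoped ComplexOrder Kronecker

namespace LiebWuPF

/-! ### Perron–Frobenius for Lieb's reduced Hamiltonian on coefficient matrices -/

section LiebOp

variable {A X : Type*} [Fintype A] [DecidableEq A] [Fintype X]

/-- **Perron–Frobenius for `𝓗 W = K W + W K + U Σ_x L_x W L_x`.** Let `K` be real symmetric with
nonpositive off-diagonal entries and connected hopping graph, `L_x` real diagonal, `U` real, and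
`E` a lower bound of `Re ⟨W, 𝓗 W⟩ / ‖W‖²`. Then the solutions of `𝓗 W = E W` are unique up to
scalars, and a nonzero one is a constant multiple of an entrywise strictly positive real matrix.
(Vectorise: `vec (𝓗 W) = (1 ⊗ K + Kᵀ ⊗ 1 + U Σ_x L_xᵀ ⊗ L_x) vec W`, a real symmetric matrix on
`A × A` with nonpositive off-diagonal entries and connected graph; apply
`perronFrobenius_groundState_unique` / `perronFrobenius_groundState_smul_pos`.)
Lieb–Wu, Physica A 321 (2003) 1, §2, items 1.–2. (the matrix `Ĥ` on `ℓ²(R)`).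
[cite: LiebWuPhysicaA2003, §2, items 1–2] -/
theorem liebOp_perronFrobenius {K : Matrix A A ℂ} (hKsymm : ∀ a b, K a b = K b a)
    (hKreal : ∀ a b, star (K a b) = K a b) (hKoff : ∀ a b, a ≠ b → (K a b).re ≤ 0)
    (hKconn : ∀ a b, Relation.ReflTransGen (fun a b => a ≠ b ∧ K a b ≠ 0) a b)
    {L : X → Matrix A A ℂ} (hLdiag : ∀ x a b, a ≠ b → L x a b = 0)
    (hLreal : ∀ x a, star (L x a a) = L x a a) (U : ℝ) {E : ℝ}
    (hE : ∀ Z : Matrix A A ℂ, E * (hsInner Z Z).re ≤ (hsInner Z (liebOp K L U Z)).re) :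
    (∀ W₁ W₂ : Matrix A A ℂ, liebOp K L U W₁ = (E : ℂ) • W₁ → liebOp K L U W₂ = (E : ℂ) • W₂ →
        W₁ ≠ 0 → ∃ c : ℂ, W₂ = c • W₁) ∧
      ∀ W : Matrix A A ℂ, liebOp K L U W = (E : ℂ) • W → W ≠ 0 →
        ∃ c : ℂ, c ≠ 0 ∧ ∀ a b, 0 < (c * W a b).re ∧ (c * W a b).im = 0 := by
  -- the vectorised operator
  set M : Matrix (A × A) (A × A) ℂ :=
    (1 : Matrix A A ℂ) ⊗ₖ K + Kᵀ ⊗ₖ (1 : Matrix A A ℂ) + (U : ℂ) • ∑ x, (L x)ᵀ ⊗ₖ L x with hM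
  have hMvec : ∀ W : Matrix A A ℂ, M *ᵥ vec W = vec (liebOp K L U W) := by
    intro W
    simp only [hM, add_mulVec, smul_mulVec, Matrix.sum_mulVec, kronecker_mulVec_vec,
      transpose_one, transpose_transpose, Matrix.mul_one, Matrix.one_mul, liebOp, vec_add,
      vec_smul, vec_sum]
  have hMapply : ∀ a b a' b' : A, M (a, b) (a', b') =
      (1 : Matrix A A ℂ) a a' * K b b' + K a' a * (1 : Matrix A A ℂ) b b' +
        (U : ℂ) * ∑ x, L x a' a * L x b b' := by
    intro a b a' b'
    simp only [hM, Matrix.add_apply, Matrix.smul_apply, Matrix.sum_apply, kronecker_apply,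
      transpose_apply, smul_eq_mul]
  -- the `L`-term is diagonal
  have hLterm : ∀ a b a' b' : A, (a, b) ≠ (a', b') → ∑ x, L x a' a * L x b b' = 0 := by
    intro a b a' b' hne
    refine Finset.sum_eq_zero fun x _ => ?_
    by_cases ha : a = a'
    · subst ha
      have hb : b ≠ b' := fun h => hne (by rw [h])
      rw [hLdiag x b b' hb, mul_zero]
    · rw [hLdiag x a' a (Ne.symm ha), zero_mul]
  have hMsymm : ∀ p q, M p q = M q p := by
    rintro ⟨a, b⟩ ⟨a', b'⟩
    by_cases h : (a, b) = (a', b')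
    · rw [h]
    · rw [hMapply, hMapply, hLterm a b a' b' h, hLterm a' b' a b (Ne.symm h), hKsymm b b',
        hKsymm a' a, one_apply, one_apply, one_apply, one_apply]
      simp only [eq_comm]
  have hMreal : ∀ p q, star (M p q) = M p q := by
    rintro ⟨a, b⟩ ⟨a', b'⟩
    by_cases h : (a, b) = (a', b')
    · obtain ⟨rfl, rfl⟩ := Prod.mk.inj h
      rw [hMapply]
      simp only [star_add, star_mul', star_sum, one_apply_eq, star_one, hKreal, hLreal,
        Complex.star_def, Complex.conj_ofReal]
    · rw [hMapply, hLterm a b a' b' h, mul_zero, add_zero, star_add, star_mul', star_mul', hKreal,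
        hKreal, one_apply, one_apply]
      simp only [apply_ite (star : ℂ → ℂ), star_one, star_zero]
  have hMoff : ∀ p q, p ≠ q → (M p q).re ≤ 0 := by
    rintro ⟨a, b⟩ ⟨a', b'⟩ h
    rw [hMapply, hLterm a b a' b' h, mul_zero, add_zero, one_apply, one_apply]
    by_cases ha : a = a'
    · subst ha
      have hb : b ≠ b' := fun h' => h (by rw [h'])
      rw [if_pos rfl, if_neg hb, one_mul, mul_zero, add_zero]
      exact hKoff b b' hb
    · rw [if_neg ha, zero_mul, zero_add]
      by_cases hb : b = b'
      · rw [if_pos hb, mul_one]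
        exact hKoff a' a (Ne.symm ha)
      · rw [if_neg hb, mul_zero, Complex.zero_re]
  have hMconn : ∀ p q, Relation.ReflTransGen (fun p q => M p q ≠ 0) p q := by
    -- move the second coordinate, then the first
    have h2 : ∀ (c a a' : A), Relation.ReflTransGen (fun p q => M p q ≠ 0) (c, a) (c, a') := by
      intro c a a'
      induction hKconn a a' with
      | refl => exact Relation.ReflTransGen.refl
      | @tail b b' _ hbb' ih =>
        refine Relation.ReflTransGen.tail ih ?_
        show M (c, b) (c, b') ≠ 0
        have hne : (c, b) ≠ (c, b') := fun h => hbb'.1 (Prod.mk.inj h).2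
        rw [hMapply, hLterm c b c b' hne, mul_zero, add_zero, one_apply_eq, one_mul,
          one_apply_ne hbb'.1, mul_zero, add_zero]
        exact hbb'.2
    have h1 : ∀ (c a a' : A), Relation.ReflTransGen (fun p q => M p q ≠ 0) (a, c) (a', c) := by
      intro c a a'
      induction hKconn a a' with
      | refl => exact Relation.ReflTransGen.refl
      | @tail b b' _ hbb' ih =>
        refine Relation.ReflTransGen.tail ih ?_
        show M (b, c) (b', c) ≠ 0
        have hne : (b, c) ≠ (b', c) := fun h => hbb'.1 (Prod.mk.inj h).1
        rw [hMapply, hLterm b c b' c hne, mul_zero, add_zero, one_apply_ne hbb'.1, zero_mul,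
          zero_add, one_apply_eq, mul_one, hKsymm]
        exact hbb'.2
    rintro ⟨a, b⟩ ⟨a', b'⟩
    exact (h2 a b b').trans (h1 b' a a')
  have hinner : ∀ Z W : Matrix A A ℂ, star (vec Z) ⬝ᵥ vec W = hsInner Z W := fun Z W => by
    rw [star_vec_dotProduct_vec]
    rfl
  have hvec_surj : ∀ v : A × A → ℂ, ∃ Z : Matrix A A ℂ, vec Z = v := fun v =>
    ⟨Matrix.of fun a b => v (b, a), funext fun ⟨i, j⟩ => rfl⟩
  have hE' : ∀ v : A × A → ℂ, E * (star v ⬝ᵥ v).re ≤ (star v ⬝ᵥ M *ᵥ v).re := by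
    intro v
    obtain ⟨Z, rfl⟩ := hvec_surj v
    rw [hMvec, hinner, hinner]
    exact hE Z
  have heig : ∀ W : Matrix A A ℂ, liebOp K L U W = (E : ℂ) • W → M *ᵥ vec W = (E : ℂ) • vec W := by
    intro W hW
    rw [hMvec, hW, vec_smul]
  refine ⟨fun W₁ W₂ h₁ h₂ hne => ?_, fun W hW hne => ?_⟩
  · have hne' : vec W₁ ≠ 0 := fun h => hne (vec_eq_zero_iff.1 h)
    obtain ⟨c, hc⟩ := perronFrobenius_groundState_unique hMsymm hMreal hMoff hMconn hE'
      (heig W₁ h₁) (heig W₂ h₂) hne'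
    refine ⟨c, vec_inj.1 ?_⟩
    rw [hc, vec_smul]
  · have hne' : vec W ≠ 0 := fun h => hne (vec_eq_zero_iff.1 h)
    obtain ⟨c, hc0, hc⟩ := perronFrobenius_groundState_smul_pos hMsymm hMreal hMoff hMconn hE'
      (heig W hW) hne'
    exact ⟨c, hc0, fun a b => hc (b, a)⟩

end LiebOp

/-! ### The Jordan–Wigner sign of a hop -/

section JW

variable {Λ : Type*} [LinearOrder Λ]

/-- The Jordan–Wigner sign of the hop `y → x` (`x < y`) over the configuration `γ ∌ x` of the
other particles is the parity of the number of particles strictly between `x` and `y`: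
`jwSign x γ · jwSign y γ = (-1)^{#{z ∈ γ | x < z < y}}`. Lieb–Wu, Physica A 321 (2003) 1, §2
(the sign `(-1)^{M-1}` of eq. (pbc)). [cite: LiebWuPhysicaA2003, §2] -/
theorem jwSign_mul_jwSign_of_lt {x y : Λ} (hxy : x < y) {γ : Finset Λ} (hx : x ∉ γ) :
    jwSign x γ * jwSign y γ = (-1) ^ (γ.filter fun z => x < z ∧ z < y).card := by
  have hsplit : (γ.filter (· < y)) = (γ.filter (· < x)) ∪ (γ.filter fun z => x < z ∧ z < y) := by
    ext z
    simp only [mem_filter, mem_union]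
    constructor
    · rintro ⟨hz, hzy⟩
      rcases lt_or_ge z x with h | h
      · exact Or.inl ⟨hz, h⟩
      · exact Or.inr ⟨hz, lt_of_le_of_ne h (fun h' => hx (h' ▸ hz)), hzy⟩
    · rintro (⟨hz, hzx⟩ | ⟨hz, -, hzy⟩)
      · exact ⟨hz, hzx.trans hxy⟩
      · exact ⟨hz, hzy⟩
  have hdisj : Disjoint (γ.filter (· < x)) (γ.filter fun z => x < z ∧ z < y) := by
    rw [Finset.disjoint_filter]
    intro z _ hzx h
    exact lt_asymm hzx h.1
  rw [jwSign, jwSign, hsplit, card_union_of_disjoint hdisj, pow_add, ← mul_assoc, ← pow_add,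
    ← two_mul, pow_mul, neg_one_sq, one_pow, one_mul]

end JW

/-! ### The ring: connectedness and the signs of the hopping matrix -/

section Ring

open ThermodynamicLimit

/-- The ring `ℤ/Lℤ` (as `fermionTorusGraph 1 L`) is preconnected: consecutive representatives
`k`, `k + 1 < L` are adjacent. [folklore] -/
theorem fermionTorusGraph_one_preconnected (L : ℕ) : (fermionTorusGraph 1 L).Preconnected := by
  -- reach every site from any site with a smaller representative
  have key : ∀ (d : ℕ) (x y : FermionTorus 1 L), (ofLex y 0 : ℕ) = ofLex x 0 + d →
      (fermionTorusGraph 1 L).Reachable x y := by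
    intro d
    induction d with
    | zero =>
      intro x y h
      rw [add_zero] at h
      rw [fermionTorus_one_ext_val h]
    | succ d ih =>
      intro x y h
      have hyL := (ofLex y 0).isLt
      set y' : FermionTorus 1 L := toLex fun _ : Fin 1 => (⟨ofLex x 0 + d, by omega⟩ : Fin L) with hy'
      have hy'v : (ofLex y' 0 : ℕ) = ofLex x 0 + d := rfl
      have h1 : (fermionTorusGraph 1 L).Reachable x y' := ih x y' hy'v
      have h2 : (fermionTorusGraph 1 L).Adj y' y := by
        rw [fermionTorusGraph_one_adj_iff, hy'v, h]
        refine ⟨by omega, Or.inl ?_⟩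
        rw [Nat.mod_eq_of_lt (by omega)]
        ring
      exact h1.trans h2.reachable
  intro x y
  rcases le_total (ofLex x 0 : ℕ) (ofLex y 0 : ℕ) with h | h
  · exact key _ x y (Nat.add_sub_cancel' h).symm
  · exact (key _ y x (Nat.add_sub_cancel' h).symm).symm

/-- Adjacent ring sites `x < y` (in the order of representatives) are either consecutive,
`y = x + 1`, or the wrap-around bond `x = 0`, `y = L - 1`. [folklore] -/
theorem ring_adj_lt_cases {L : ℕ} {x y : FermionTorus 1 L} (hadj : (fermionTorusGraph 1 L).Adj x y)
    (hxy : x < y) :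
    (ofLex y 0 : ℕ) = (ofLex x 0 : ℕ) + 1 ∨ ((ofLex x 0 : ℕ) = 0 ∧ (ofLex y 0 : ℕ) + 1 = L) := by
  have hval : ∀ u v : FermionTorus 1 L, u < v ↔ (ofLex u 0 : ℕ) < ofLex v 0 := fun u v =>
    Pi.Lex.lt_iff_of_unique.trans Fin.lt_def
  have hlt : (ofLex x 0 : ℕ) < (ofLex y 0 : ℕ) := (hval x y).1 hxy
  have hxL := (ofLex x 0).isLt
  have hyL := (ofLex y 0).isLt
  obtain ⟨-, h | h⟩ := (fermionTorusGraph_one_adj_iff x y).1 hadj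
  · left
    rcases Nat.lt_or_ge ((ofLex x 0 : ℕ) + 1) L with h1 | h1
    · rw [Nat.mod_eq_of_lt h1] at h
      exact h.symm
    · have e : (ofLex x 0 : ℕ) + 1 = L := by omega
      rw [e, Nat.mod_self] at h
      omega
  · right
    rcases Nat.lt_or_ge ((ofLex y 0 : ℕ) + 1) L with h1 | h1
    · rw [Nat.mod_eq_of_lt h1] at h
      omega
    · have e : (ofLex y 0 : ℕ) + 1 = L := by omega
      rw [e, Nat.mod_self] at h
      exact ⟨h.symm, e⟩

/-- **The sign of a hop on the ring.** For a ring bond `{x, y}` and a configuration `γ` of the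
other particles (`x, y ∉ γ`) of even size, the Jordan–Wigner sign of the hop is `+1`: no particle
lies strictly between consecutive sites, and all `#γ` of them lie strictly between `0` and
`L - 1`. This is Lieb–Wu's `(-1)^{M-1} = 1` for `M` odd. Lieb–Wu, Physica A 321 (2003) 1, §2,
eq. (pbc) and the sentence following it. [cite: LiebWuPhysicaA2003, §2] -/
theorem ring_jwSign_mul_jwSign {L : ℕ} {x y : FermionTorus 1 L}
    (hadj : (fermionTorusGraph 1 L).Adj x y) {γ : Finset (FermionTorus 1 L)} (hx : x ∉ γ)
    (hy : y ∉ γ) (hγ : Even γ.card) : jwSign x γ * jwSign y γ = 1 := by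
  have hval : ∀ u v : FermionTorus 1 L, u < v ↔ (ofLex u 0 : ℕ) < ofLex v 0 := fun u v =>
    Pi.Lex.lt_iff_of_unique.trans Fin.lt_def
  wlog hxy : x < y generalizing x y
  · have hyx : y < x := lt_of_le_of_ne (not_lt.1 hxy) hadj.ne.symm
    rw [mul_comm]
    exact this hadj.symm hy hx hyx
  rw [jwSign_mul_jwSign_of_lt hxy hx]
  rcases ring_adj_lt_cases hadj hxy with h | ⟨hx0, hyL⟩
  · have he : γ.filter (fun z => x < z ∧ z < y) = ∅ := by
      rw [Finset.filter_eq_empty_iff]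
      rintro z - ⟨h1, h2⟩
      rw [hval] at h1 h2
      omega
    rw [he, card_empty, pow_zero]
  · have he : γ.filter (fun z => x < z ∧ z < y) = γ := by
      rw [Finset.filter_eq_self]
      intro z hz
      rw [hval, hval]
      have hzx : (ofLex z 0 : ℕ) ≠ ofLex x 0 := fun h => hx (by rwa [fermionTorus_one_ext_val h] at hz)
      have hzy : (ofLex z 0 : ℕ) ≠ ofLex y 0 := fun h => hy (by rwa [fermionTorus_one_ext_val h] at hz)
      have := (ofLex z 0).isLt
      omega
    rw [he, Even.neg_one_pow hγ]

end Ring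

/-! ### Hopping matrices with nonpositive entries -/

section Sign

variable {Λ : Type*} [LinearOrder Λ] [Fintype Λ] {G : SimpleGraph Λ} [DecidableRel G.Adj]

/-- If every hop across a bond of `G` over an even number of other particles has Jordan–Wigner
sign `+1`, then for `t ≥ 0` and `n` odd every entry of Lieb's hopping matrix `K = liebK G t n` has
nonpositive real part: an entry of `K` is `-t Σ_{x ∼ y} (c†_x c_y)_{αβ}`, and each matrix element
`(c†_x c_y)_{αβ}` is `0` or the sign of the hop `y → x` over the `n - 1` particles of `α ∖ x`.
Lieb–Wu, Physica A 321 (2003) 1, §2 ("all the off-diagonal terms in the Hamiltonian ... are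
non-positive"). [cite: LiebWuPhysicaA2003, §2] -/
theorem re_liebK_nonpos_of_sign {t : ℝ} (ht : 0 ≤ t) {n : ℕ} (hn : Odd n)
    (hsign : ∀ x y : Λ, G.Adj x y → ∀ γ : Finset Λ, x ∉ γ → y ∉ γ → Even γ.card →
      jwSign x γ * jwSign y γ = 1)
    (α β : Config Λ n) : (liebK G t n α β).re ≤ 0 := by
  rw [liebK, hoppingMatrix_apply]
  have hterm : ∀ x y : Λ, 0 ≤ ((if G.Adj x y then
      (creation x * annihilation y) α.1 β.1 else 0 : ℂ)).re := by
    intro x y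
    split_ifs with hadj
    · rw [LiebThm1.creation_mul_annihilation_apply]
      split_ifs with hcond
      · obtain ⟨hxs, hys, -⟩ := hcond
        have hγ : Even (α.1.erase x).card := by
          rw [card_erase_of_mem hxs, α.2]
          exact Nat.Odd.sub_odd hn odd_one
        rw [hsign x y hadj _ (Finset.notMem_erase x α.1) hys hγ, Complex.one_re]
        exact zero_le_one
      · rw [Complex.zero_re]
    · rw [Complex.zero_re]
  have hsum : 0 ≤ (∑ x, ∑ y, (if G.Adj x y then
      (creation x * annihilation y) α.1 β.1 else 0 : ℂ)).re := by
    rw [Complex.re_sum]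
    refine Finset.sum_nonneg fun x _ => ?_
    rw [Complex.re_sum]
    exact Finset.sum_nonneg fun y _ => hterm x y
  rw [neg_mul, Complex.neg_re, neg_nonpos, Complex.re_ofReal_mul]
  exact mul_nonneg ht hsum

/-- **Nonpositivity of the hopping matrix on the ring for an odd number of particles.** For
`t ≥ 0` and `n` odd, every entry of Lieb's hopping matrix `liebK (fermionTorusGraph 1 L) t n` of
`n` spinless fermions on the ring has nonpositive real part (`re_liebK_nonpos_of_sign` with the
ring signs `ring_jwSign_mul_jwSign`). Lieb–Wu, Physica A 321 (2003) 1, §2 ("this is where we use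
the fact that `(-1)^{M-1} = (-1)^{M'-1} = 1`"). [cite: LiebWuPhysicaA2003, §2] -/
theorem re_liebK_ring_nonpos {L : ℕ} {t : ℝ} (ht : 0 ≤ t) {n : ℕ} (hn : Odd n)
    (α β : Config (FermionTorus 1 L) n) : (liebK (fermionTorusGraph 1 L) t n α β).re ≤ 0 :=
  re_liebK_nonpos_of_sign ht hn (fun _ _ hadj _ hx hy hγ => ring_jwSign_mul_jwSign hadj hx hy hγ) α β

end Sign

/-! ### Connectedness of the hopping graph on configurations -/

section Connected

variable {Λ : Type*} [LinearOrder Λ] [Fintype Λ] {G : SimpleGraph Λ} [DecidableRel G.Adj]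

/-- A hopping move has a nonzero entry of `K` (`t ≠ 0`). Lieb, PRL 62 (1989) 1201, proof of
Theorem 1. [cite: LiebPRL1989, proof of Theorem 1] -/
theorem liebK_ne_zero_of_isHop {t : ℝ} (ht : t ≠ 0) {n : ℕ} {α β : Config Λ n}
    (h : IsHop G α.1 β.1) : liebK G t n α β ≠ 0 := by
  obtain ⟨x, y, hxy, hy, hx, hβ⟩ := h
  rw [← LiebThm1.liebK_symm t n α β, liebK, hβ]
  exact LiebThm1.hoppingMatrix_hop_ne_zero ht hxy hy hx

/-- On a preconnected graph with `t ≠ 0`, any two `n`-particle configurations are joined by a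
chain of configurations with consecutive nonzero entries of `K` ("the `α`'s are connected by
`K`"; Lieb–Wu: "tracing this backward, `g(X) = 0` for every `X ∈ R`"). Lieb, PRL 62 (1989) 1201,
proof of Theorem 1; Lieb–Wu, Physica A 321 (2003) 1, §2. [cite: LiebWuPhysicaA2003, §2] -/
theorem reflTransGen_liebK_ne_zero (hG : G.Preconnected) {t : ℝ} (ht : t ≠ 0) {n : ℕ}
    (α β : Config Λ n) :
    Relation.ReflTransGen (fun a b : Config Λ n => a ≠ b ∧ liebK G t n a b ≠ 0) α β := by
  have key : ∀ γ : Finset Λ, Relation.ReflTransGen (IsHop G) α.1 γ → ∀ hγ : γ.card = n,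
      Relation.ReflTransGen (fun a b : Config Λ n => a ≠ b ∧ liebK G t n a b ≠ 0) α ⟨γ, hγ⟩ := by
    intro γ h
    induction h with
    | refl => intro _; exact Relation.ReflTransGen.refl
    | @tail b c _ hbc ih =>
      intro hc
      have hb : b.card = n := hbc.card_eq ▸ hc
      refine Relation.ReflTransGen.tail (ih hb)
        ⟨?_, liebK_ne_zero_of_isHop (α := ⟨b, hb⟩) (β := ⟨c, hc⟩) ht hbc⟩
      obtain ⟨x, y, -, -, hx, rfl⟩ := hbc
      intro h
      have h' : b = insert x (b.erase y) := congrArg Subtype.val h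
      rw [h'] at hx
      exact hx (mem_insert_self x _)
  exact key β.1 (reflTransGen_isHop hG (by rw [α.2, β.2])) β.2

end Connected

/-! ### The sector ground state for a hopping matrix with nonpositive entries -/

section Sector

variable {Λ : Type*} [LinearOrder Λ] [Fintype Λ] (G : SimpleGraph Λ) [DecidableRel G.Adj]

/-- **Perron–Frobenius in the `(n, n)` sector.** On a preconnected graph with `t ≠ 0` and real
`U`, suppose Lieb's hopping matrix `K = liebK G t n` has nonpositive off-diagonal entries, and let
`E` bound the Hubbard Hamiltonian from below on the `(n, n)` sector. Then sector eigenvectors of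
`H` at `E` are unique up to scalars, and a nonzero one has, after multiplication by a nonzero
constant, all Lieb coefficients `W_{αβ} = σ(α,β) ψ(α↑ ∪ β↓)` real and strictly positive.
(Transfer `ψ ↦ W` as in `LiebThm1.isLiebSystem_hubbard`, then `liebOp_perronFrobenius`.)
Lieb–Wu, Physica A 321 (2003) 1, §2, items 1.–2. [cite: LiebWuPhysicaA2003, §2, items 1–2] -/
theorem sector_groundState (hG : G.Preconnected) {t : ℝ} (ht : t ≠ 0) (U : ℝ) {n : ℕ}
    (hK : ∀ α β : Config Λ n, α ≠ β → (liebK G t n α β).re ≤ 0) {E : ℝ}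
    (hE : ∀ φ : Fock (Orb Λ), IsInSector n n φ →
      E * (star φ ⬝ᵥ φ).re ≤ (expect (hamiltonian G t U) φ).re) :
    (∀ ψ₁ ψ₂ : Fock (Orb Λ), IsInSector n n ψ₁ → IsInSector n n ψ₂ →
        hamiltonian G t U *ᵥ ψ₁ = (E : ℂ) • ψ₁ → hamiltonian G t U *ᵥ ψ₂ = (E : ℂ) • ψ₂ →
        ψ₁ ≠ 0 → ∃ c : ℂ, ψ₂ = c • ψ₁) ∧
      ∀ ψ : Fock (Orb Λ), IsInSector n n ψ → hamiltonian G t U *ᵥ ψ = (E : ℂ) • ψ → ψ ≠ 0 →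
        ∃ c : ℂ, c ≠ 0 ∧ ∀ α β : Config Λ n,
          0 < (c * liebW n ψ α β).re ∧ (c * liebW n ψ α β).im = 0 := by
  -- hypotheses of the matrix theorem
  have hKsymm : ∀ a b : Config Λ n, liebK G t n a b = liebK G t n b a :=
    fun a b => LiebThm1.liebK_symm (G := G) t n b a
  have hKreal : ∀ a b : Config Λ n, star (liebK G t n a b) = liebK G t n a b :=
    fun a b => LiebThm1.star_liebK (G := G) t n a b
  have hLdiag : ∀ (x : Λ) (a b : Config Λ n), a ≠ b → liebL n x a b = 0 :=
    fun x a b hab => diagonal_apply_ne _ hab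
  have hLreal : ∀ (x : Λ) (a : Config Λ n), star (liebL n x a a) = liebL n x a a := by
    intro x a
    rw [liebL, diagonal_apply_eq]
    split_ifs <;> simp
  have hE' : ∀ Z : Matrix (Config Λ n) (Config Λ n) ℂ,
      E * (hsInner Z Z).re ≤ (hsInner Z (liebOp (liebK G t n) (liebL n) U Z)).re := by
    intro Z
    set φ := liebVec n Z with hφdef
    have hφ : IsInSector n n φ := isInSector_liebVec n Z
    have hZ : Z = liebW n φ := (LiebThm1.liebW_liebVec n Z).symm
    rw [hZ, ← LiebThm1.liebW_hamiltonian_mulVec, LiebThm1.hsInner_liebW hφ,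
      LiebThm1.hsInner_liebW hφ]
    exact hE φ hφ
  obtain ⟨huniq, hpos⟩ := liebOp_perronFrobenius hKsymm hKreal hK
    (reflTransGen_liebK_ne_zero hG ht) hLdiag hLreal U hE'
  have hgs : ∀ ψ : Fock (Orb Λ), hamiltonian G t U *ᵥ ψ = (E : ℂ) • ψ →
      liebOp (liebK G t n) (liebL n) U (liebW n ψ) = (E : ℂ) • liebW n ψ := by
    intro ψ hψ
    rw [← LiebThm1.liebW_hamiltonian_mulVec, hψ, liebW_smul]
  refine ⟨fun ψ₁ ψ₂ h₁ h₂ e₁ e₂ hne => ?_, fun ψ hψ e hne => ?_⟩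
  · have hW₁ : liebW n ψ₁ ≠ 0 := fun h => hne ((LiebThm1.liebW_eq_zero_iff h₁).1 h)
    obtain ⟨c, hc⟩ := huniq _ _ (hgs ψ₁ e₁) (hgs ψ₂ e₂) hW₁
    refine ⟨c, ?_⟩
    rw [← sub_eq_zero, ← LiebThm1.liebW_eq_zero_iff (h₂.sub (h₁.smul c)), liebW_sub, liebW_smul,
      hc, sub_self]
  · have hW : liebW n ψ ≠ 0 := fun h => hne ((LiebThm1.liebW_eq_zero_iff hψ).1 h)
    exact hpos _ (hgs ψ e) hW

end Sector

end LiebWuPF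

/-! ### The sector `(N, S^z) = (2n, 0)` and its ground states -/

section SzSector

variable {Λ : Type*} [LinearOrder Λ] [Fintype Λ] (G : SimpleGraph Λ) [DecidableRel G.Adj]

omit [Fintype Λ] in
/-- The joint sector `(N, S^z) = (2n, 0)` of `QLattice.szSector` is Lieb's `(n, n)` sector
(`n` up and `n` down electrons). Lieb, PRL 62 (1989) 1201, proof of Theorem 1 ("I work in the
`S^z = 0` subspace"). [cite: LiebPRL1989, proof of Theorem 1] -/
theorem mem_szSector_two_mul_zero_iff [Fintype Λ] (n : ℕ) (ψ : Fock (Orb Λ)) :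
    ψ ∈ szSector (2 * n) 0 ↔ IsInSector n n ψ := by
  rw [mem_szSector_iff]
  constructor
  · rintro ⟨hN, hZ⟩ s hs
    by_cases hcard : s.card = 2 * n
    · have h := congrFun hZ s
      rw [LiebThm1.spinZ_mulVec_apply, Pi.smul_apply, smul_eq_mul, Complex.ofReal_zero,
        zero_mul] at h
      rcases mul_eq_zero.1 h with h1 | h1
      · exfalso
        have hsum : (upPart s).card + (downPart s).card = 2 * n := by
          rw [← card_eq_upPart_add_downPart, hcard]
        rcases mul_eq_zero.1 h1 with h2 | h2
        · norm_num at h2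
        · have h3 : ((upPart s).card : ℂ) = (downPart s).card := sub_eq_zero.1 h2
          have h4 : (upPart s).card = (downPart s).card := by exact_mod_cast h3
          exact hs ⟨by omega, by omega⟩
      · exact h1
    · exact hN s hcard
  · intro h
    refine ⟨?_, ?_⟩
    · have := h.isNParticle
      rwa [← two_mul] at this
    · rw [LiebThm1.spinZ_mulVec_of_isInSector h, sub_self, mul_zero, Complex.ofReal_zero]

/-- From the bound on unit vectors to the homogeneous bound `E ‖φ‖² ≤ Re ⟨φ, H φ⟩` on a sector
(normalise `φ ≠ 0`). Tasaki (2020) §2.1. [folklore] -/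
theorem mul_norm_le_of_unit_bound (H : Matrix (Finset (Orb Λ)) (Finset (Orb Λ)) ℂ) {n : ℕ} {E : ℝ}
    (hb : ∀ v ∈ szSector (2 * n) (0 : ℝ), star v ⬝ᵥ v = 1 → E ≤ (star v ⬝ᵥ H *ᵥ v).re)
    {φ : Fock (Orb Λ)} (hφ : IsInSector n n φ) : E * (star φ ⬝ᵥ φ).re ≤ (expect H φ).re := by
  by_cases h0 : φ = 0
  · subst h0
    simp [expect]
  obtain ⟨c, hc0, hc1⟩ := exists_smul_unit h0
  have hmem : c • φ ∈ szSector (2 * n) (0 : ℝ) :=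
    Submodule.smul_mem _ c ((mem_szSector_two_mul_zero_iff n φ).2 hφ)
  have h2 := hb _ hmem hc1
  have hcc : star c * c = ((‖c‖ ^ 2 : ℝ) : ℂ) := by
    rw [Complex.star_def, Complex.conj_mul']
    push_cast
    rfl
  rw [mulVec_smul, star_smul, smul_dotProduct, dotProduct_smul, smul_smul, hcc, smul_eq_mul,
    Complex.re_ofReal_mul] at h2
  rw [star_smul, smul_dotProduct, dotProduct_smul, smul_smul, hcc, smul_eq_mul] at hc1
  have h1 : ‖c‖ ^ 2 * (star φ ⬝ᵥ φ).re = 1 := by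
    have := congrArg Complex.re hc1
    rwa [Complex.re_ofReal_mul, Complex.one_re] at this
  have hpos : 0 < ‖c‖ ^ 2 := by positivity
  have key : ‖c‖ ^ 2 * (E * (star φ ⬝ᵥ φ).re) ≤ ‖c‖ ^ 2 * (expect H φ).re :=
    calc ‖c‖ ^ 2 * (E * (star φ ⬝ᵥ φ).re) = E * (‖c‖ ^ 2 * (star φ ⬝ᵥ φ).re) := by ring
      _ = E := by rw [h1, mul_one]
      _ ≤ ‖c‖ ^ 2 * (expect H φ).re := h2
  exact le_of_mul_le_mul_left key hpos

/-- **Ground states exist in the sector `(2n, 0)`** (`n ≤ |Λ|`), and the sector energy bounds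
`H` from below on the `(n, n)` sector: the Hubbard Hamiltonian is Hermitian and block diagonal in
the sectors `(N↑, N↓)`, so `QLattice.sector_groundState` applies to the coordinate subspace
`szSector (2n) 0`. Tasaki (2020) §2.2; Lieb, PRL 62 (1989) 1201, proof of Theorem 1. [folklore] -/
theorem szSector_groundState (t U : ℝ) {n : ℕ} (hn : n ≤ Fintype.card Λ) :
    (∃ ψ, IsGroundStateInSector (hamiltonian G t U) (2 * n) 0 ψ) ∧
      ∀ φ : Fock (Orb Λ), IsInSector n n φ →
        (hamiltonian G t U).minEnergyOn (szSector (2 * n) 0) * (star φ ⬝ᵥ φ).re ≤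
          (expect (hamiltonian G t U) φ).re := by
  classical
  obtain ⟨α₀, -, hα₀⟩ : ∃ α₀ : Finset Λ, α₀ ⊆ univ ∧ α₀.card = n :=
    Finset.exists_subset_card_eq (by rwa [Finset.card_univ])
  have hp : ∃ s : Finset (Orb Λ), (upPart s).card = n ∧ (downPart s).card = n :=
    ⟨pairSet α₀ α₀, by rw [upPart_pairSet, hα₀], by rw [downPart_pairSet, hα₀]⟩
  have hinv : ∀ s s' : Finset (Orb Λ), ¬((upPart s).card = n ∧ (downPart s).card = n) →
      ((upPart s').card = n ∧ (downPart s').card = n) → hamiltonian G t U s s' = 0 := by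
    intro s s' hs hs'
    by_contra h
    have := LiebThm1.preservesSectors_hamiltonian G t U s s' h
    exact hs ⟨this.1.trans hs'.1, this.2.trans hs'.2⟩
  have hK : ∀ v : Fock (Orb Λ), v ∈ szSector (2 * n) (0 : ℝ) ↔
      ∀ s, ¬((upPart s).card = n ∧ (downPart s).card = n) → v s = 0 :=
    fun v => mem_szSector_two_mul_zero_iff n v
  obtain ⟨⟨v, hv, hv0, hHv⟩, hb⟩ := Literature.MathematicalPhysics.QuantumLattice.sector_groundState (hamiltonian G t U)
    (LiebThm1.hamiltonian_isHermitian G t U) (fun s => (upPart s).card = n ∧ (downPart s).card = n)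
    hp hinv (szSector (2 * n) 0) hK
  exact ⟨⟨v, hv, hv0, hHv⟩, fun φ hφ => mul_norm_le_of_unit_bound _ hb hφ⟩

end SzSector

/-! ### `SU(2)`: the `N`-particle ground-state energy is attained at `S^z = 0` -/

section SU2

variable {Λ : Type*} [LinearOrder Λ] [Fintype Λ] (G : SimpleGraph Λ) [DecidableRel G.Adj]

/-- **The ground-state energy in the `N = 2n` sector is the ground-state energy in the joint sector
`(2n, S^z = 0)`** (every spin multiplet has a representative at `S^z = 0`): `H` conserves
`(N↑, N↓)` and commutes with `S^±`; a ground state has a nonzero sector component `(a, b)`,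
`a + b = 2n`, which `S⁻` (if `a > b`; `S⁺` if `a < b`) maps injectively, step by step, to a nonzero
eigenvector with the same energy in the `(n, n)` sector. Lieb, PRL 62 (1989) 1201, proof of
Theorem 1 ("all competitors have a representative there"); Lieb–Wu, Physica A 321 (2003) 1, §5
("so we are allowed to take `S^z = 0`"). [cite: LiebPRL1989, proof of Theorem 1] -/
theorem groundEnergyAt_eq_minEnergyOn_szSector (t U : ℝ) {n : ℕ} (hn : n ≤ Fintype.card Λ) :
    groundEnergyAt G t U (2 * n) =
      (hamiltonian G t U).minEnergyOn (szSector (2 * n) 0) := by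
  classical
  set H := hamiltonian G t U with hH
  set E₀ : ℝ := groundEnergyAt G t U (2 * n) with hE₀
  set E₁ : ℝ := H.minEnergyOn (szSector (2 * n) 0) with hE₁
  obtain ⟨⟨ψ₁, hψ₁, hψ₁0, -⟩, hb⟩ := szSector_groundState G t U hn
  -- `E₀ ≤ E₁`: the sector Rayleigh set is contained in the `N`-particle one
  have hle : E₀ ≤ E₁ := by
    have hE₀' : E₀ = groundEnergy H (2 * n) := rfl
    rw [hE₀', groundEnergy, hE₁, Matrix.minEnergyOn]
    refine csInf_le_csInf (LiebThm1.bddBelow_energySet H (2 * n)) ?_ ?_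
    · obtain ⟨c, -, hc1⟩ := exists_smul_unit hψ₁0
      exact ⟨_, c • ψ₁, Submodule.smul_mem _ c hψ₁, hc1, rfl⟩
    · rintro E ⟨φ, hφ, hφ1, rfl⟩
      exact ⟨φ, ((mem_szSector_iff _ _ _).1 hφ).1, hφ1, rfl⟩
  -- a ground state in the `N`-particle sector
  obtain ⟨α₀, -, hα₀⟩ : ∃ α₀ : Finset Λ, α₀ ⊆ univ ∧ α₀.card = n :=
    Finset.exists_subset_card_eq (by rwa [Finset.card_univ])
  have hp : ∃ s : Finset (Orb Λ), s.card = 2 * n :=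
    ⟨pairSet α₀ α₀, by rw [card_pairSet, hα₀, two_mul]⟩
  have hinv : ∀ s s' : Finset (Orb Λ), ¬(s.card = 2 * n) → s'.card = 2 * n → H s s' = 0 := by
    intro s s' hs hs'
    by_contra h
    have := LiebThm1.preservesSectors_hamiltonian G t U s s' h
    apply hs
    rw [card_eq_upPart_add_downPart, this.1, this.2, ← card_eq_upPart_add_downPart, hs']
  obtain ⟨⟨v, hv, hv0, hHv⟩, -⟩ := Literature.MathematicalPhysics.QuantumLattice.sector_groundState H
    (LiebThm1.hamiltonian_isHermitian G t U) (fun s : Finset (Orb Λ) => s.card = 2 * n) hp hinv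
    (nParticleSubmodule (2 * n)) (fun v => Iff.rfl)
  have hvN : IsNParticle (2 * n) v := hv
  have hE₀v : H *ᵥ v = (E₀ : ℂ) • v := by
    rw [hHv, hE₀, groundEnergyAt,
      groundEnergy_eq_minEnergyOn H (2 * n) (nParticleSubmodule (2 * n)) fun ψ => Iff.rfl]
  -- `S^±` map eigenvectors to eigenvectors
  have hcommP : Commute H spinPlus := LiebThm1.hamiltonian_commute_spinPlus G t U
  have hcommM : Commute H Literature.MathematicalPhysics.QuantumLattice.spinMinus := LiebThm1.hamiltonian_commute_spinMinus G t U
  have heigP : ∀ w : Fock (Orb Λ), H *ᵥ w = (E₀ : ℂ) • w →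
      H *ᵥ (spinPlus *ᵥ w) = (E₀ : ℂ) • (spinPlus *ᵥ w) := by
    intro w hw
    rw [mulVec_mulVec, hcommP.eq, ← mulVec_mulVec, hw, mulVec_smul]
  have heigM : ∀ w : Fock (Orb Λ), H *ᵥ w = (E₀ : ℂ) • w →
      H *ᵥ (Literature.MathematicalPhysics.QuantumLattice.spinMinus *ᵥ w) = (E₀ : ℂ) • (Literature.MathematicalPhysics.QuantumLattice.spinMinus *ᵥ w) := by
    intro w hw
    rw [mulVec_mulVec, hcommM.eq, ← mulVec_mulVec, hw, mulVec_smul]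
  -- descent to the `(n, n)` sector with `S⁻` (from `a > b`) and `S⁺` (from `a < b`)
  have hB : ∀ j b : ℕ, ∀ w : Fock (Orb Λ), b + (j + 1) = n → IsInSector (b + 2 * (j + 1)) b w →
      H *ᵥ w = (E₀ : ℂ) • w → w ≠ 0 →
      ∃ w' : Fock (Orb Λ), IsInSector n n w' ∧ H *ᵥ w' = (E₀ : ℂ) • w' ∧ w' ≠ 0 := by
    intro j
    induction j with
    | zero =>
      intro b w hb hw hHw hw0
      have hw' : IsInSector (b + 1) (b + 1) (Literature.MathematicalPhysics.QuantumLattice.spinMinus *ᵥ w) :=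
        LiebThm1.lowersSpin_spinMinus.isInSector_mulVec (by simpa [two_mul, add_assoc] using hw)
      have hn' : b + 1 = n := by omega
      rw [hn'] at hw'
      exact ⟨_, hw', heigM w hHw,
        fun h0 => hw0 (LiebThm1.eq_zero_of_spinMinus_mulVec_eq_zero (by omega) hw h0)⟩
    | succ j ih =>
      intro b w hb hw hHw hw0
      have e : b + 2 * (j + 1 + 1) = (b + 1 + 2 * (j + 1)) + 1 := by ring
      rw [e] at hw
      have hw' : IsInSector (b + 1 + 2 * (j + 1)) (b + 1) (Literature.MathematicalPhysics.QuantumLattice.spinMinus *ᵥ w) :=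
        LiebThm1.lowersSpin_spinMinus.isInSector_mulVec hw
      exact ih (b + 1) _ (by omega) hw' (heigM w hHw)
        fun h0 => hw0 (LiebThm1.eq_zero_of_spinMinus_mulVec_eq_zero (by omega) hw h0)
  have hB' : ∀ j a : ℕ, ∀ w : Fock (Orb Λ), a + (j + 1) = n → IsInSector a (a + 2 * (j + 1)) w →
      H *ᵥ w = (E₀ : ℂ) • w → w ≠ 0 →
      ∃ w' : Fock (Orb Λ), IsInSector n n w' ∧ H *ᵥ w' = (E₀ : ℂ) • w' ∧ w' ≠ 0 := by
    intro j
    induction j with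
    | zero =>
      intro a w ha hw hHw hw0
      have hw' : IsInSector (a + 1) (a + 1) (spinPlus *ᵥ w) :=
        LiebThm1.raisesSpin_spinPlus.isInSector_mulVec (by simpa [two_mul, add_assoc] using hw)
      have hn' : a + 1 = n := by omega
      rw [hn'] at hw'
      exact ⟨_, hw', heigP w hHw,
        fun h0 => hw0 (LiebThm1.eq_zero_of_spinPlus_mulVec_eq_zero (by omega) hw h0)⟩
    | succ j ih =>
      intro a w ha hw hHw hw0
      have e : a + 2 * (j + 1 + 1) = (a + 1 + 2 * (j + 1)) + 1 := by ring
      rw [e] at hw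
      have hw' : IsInSector (a + 1) (a + 1 + 2 * (j + 1)) (spinPlus *ᵥ w) :=
        LiebThm1.raisesSpin_spinPlus.isInSector_mulVec hw
      exact ih (a + 1) _ (by omega) hw' (heigP w hHw)
        fun h0 => hw0 (LiebThm1.eq_zero_of_spinPlus_mulVec_eq_zero (by omega) hw h0)
  -- some sector component of `v` is nonzero; move it to the `(n, n)` sector
  have hcomp : ∀ a b : ℕ, H *ᵥ sectorProj a b v = (E₀ : ℂ) • sectorProj a b v := by
    intro a b
    rw [(LiebThm1.preservesSectors_hamiltonian G t U).mulVec_sectorProj, hE₀v, sectorProj_smul]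
  obtain ⟨a, ha, hva⟩ : ∃ a ∈ range (2 * n + 1), sectorProj a (2 * n - a) v ≠ 0 := by
    by_contra h
    simp only [not_exists, not_and, not_not] at h
    exact hv0 ((sum_sectorProj_eq hvN).symm.trans (Finset.sum_eq_zero h))
  obtain ⟨w, hw, hHw, hw0⟩ : ∃ w : Fock (Orb Λ), IsInSector n n w ∧ H *ᵥ w = (E₀ : ℂ) • w ∧ w ≠ 0 := by
    rw [mem_range] at ha
    rcases lt_trichotomy a n with hlt | rfl | hgt
    · obtain ⟨j, hj⟩ : ∃ j, a + (j + 1) = n := ⟨n - a - 1, by omega⟩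
      have e : 2 * n - a = a + 2 * (j + 1) := by omega
      refine hB' j a _ hj ?_ (hcomp _ _) hva
      rw [e]
      exact isInSector_sectorProj _ _ _
    · refine ⟨_, ?_, hcomp a (2 * a - a), hva⟩
      rw [show 2 * a - a = a by omega]
      exact isInSector_sectorProj _ _ _
    · obtain ⟨j, hj⟩ : ∃ j, (2 * n - a) + (j + 1) = n := ⟨a - n - 1, by omega⟩
      have e : a = (2 * n - a) + 2 * (j + 1) := by omega
      refine hB j (2 * n - a) _ hj ?_ (hcomp _ _) hva
      rw [← e]
      exact isInSector_sectorProj _ _ _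
  -- hence `E₁ ≤ E₀`
  have hge : E₁ ≤ E₀ := by
    have h1 := hb w hw
    rw [expect, hHw, dotProduct_smul, smul_eq_mul, Complex.re_ofReal_mul] at h1
    have hpos : 0 < (star w ⬝ᵥ w).re :=
      (Complex.pos_iff.1 (dotProduct_star_self_pos_iff.2 hw0)).1
    exact le_of_mul_le_mul_right h1 hpos
  exact le_antisymm hle hge

end SU2

/-! ### Lieb–Wu 2003, §2, items 1.–2. for the Hubbard ring -/

section Ring

open LiebWuPF

/-- **Lieb–Wu 2003, §2, items 1.–2. (uniqueness and positivity of the sector ground state of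
the Hubbard ring).** On the ring `ℤ/Lℤ` with hopping `t > 0` (Lieb–Wu's `T = -1`) and ANY real
interaction `U`, in the sector with `n` up and `n` down electrons, `n` odd: if `E` bounds `H` from
below on the sector (e.g. the sector ground-state energy), then (1.) the solutions of `H ψ = E ψ`
in the sector are unique up to scalars ("there is only one ground state"), and (2.) a nonzero one
has, up to a nonzero constant, all configuration amplitudes `W_{αβ} = σ(α,β) ψ(α↑ ∪ β↓)` real and
strictly positive ("`f(X)` is a strictly positive function in `R`"). Lieb–Wu state this for all
sectors `(M, M')` with `M`, `M'` odd; vendored is the case `M = M'` used at half filling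
(`N_a = 2 × odd`, `M = M' = N_a/2`). Lieb–Wu, Physica A 321 (2003) 1 = arXiv:cond-mat/0207529,
§2, items 1.–2. and their proof. [cite: LiebWuPhysicaA2003, §2, items 1–2] -/
theorem liebWu_sector_groundState_ring (L : ℕ) {t : ℝ} (ht : 0 < t) (U : ℝ) {n : ℕ} (hn : Odd n)
    {E : ℝ} (hE : ∀ φ : Fock (Orb (FermionTorus 1 L)), IsInSector n n φ →
      E * (star φ ⬝ᵥ φ).re ≤ (expect (hamiltonian (fermionTorusGraph 1 L) t U) φ).re) :
    (∀ ψ₁ ψ₂ : Fock (Orb (FermionTorus 1 L)), IsInSector n n ψ₁ → IsInSector n n ψ₂ →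
        hamiltonian (fermionTorusGraph 1 L) t U *ᵥ ψ₁ = (E : ℂ) • ψ₁ →
        hamiltonian (fermionTorusGraph 1 L) t U *ᵥ ψ₂ = (E : ℂ) • ψ₂ →
        ψ₁ ≠ 0 → ∃ c : ℂ, ψ₂ = c • ψ₁) ∧
      ∀ ψ : Fock (Orb (FermionTorus 1 L)), IsInSector n n ψ →
        hamiltonian (fermionTorusGraph 1 L) t U *ᵥ ψ = (E : ℂ) • ψ → ψ ≠ 0 →
        ∃ c : ℂ, c ≠ 0 ∧ ∀ α β : Config (FermionTorus 1 L) n,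
          0 < (c * liebW n ψ α β).re ∧ (c * liebW n ψ α β).im = 0 :=
  LiebWuPF.sector_groundState (fermionTorusGraph 1 L) (fermionTorusGraph_one_preconnected L) ht.ne' U
    (fun α β _ => re_liebK_ring_nonpos ht.le hn α β) hE

/-- **Lieb–Wu 2003, §2, items 1.–2., in terms of `QLattice.IsGroundStateInSector`.** On the
Hubbard ring `ℤ/Lℤ` with `t > 0` and any real `U`, in the joint sector `(N, S^z) = (2n, 0)` with
`n` odd and `n ≤ L`: a ground state exists; any two ground states are proportional ("there is only
one ground state"); and a ground state has, up to a nonzero constant, all configuration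
amplitudes `σ(α,β) ψ(α↑ ∪ β↓)` real and strictly positive ("`f(X)` is a strictly positive function
in `R`"). Lieb–Wu, Physica A 321 (2003) 1 = arXiv:cond-mat/0207529, §2, items 1.–2.
[cite: LiebWuPhysicaA2003, §2, items 1–2] -/
theorem liebWu_isGroundStateInSector_ring (L : ℕ) {t : ℝ} (ht : 0 < t) (U : ℝ) {n : ℕ}
    (hn : Odd n) (hnL : n ≤ L) :
    (∃ ψ, IsGroundStateInSector (hamiltonian (fermionTorusGraph 1 L) t U) (2 * n) 0 ψ) ∧
      (∀ ψ₁ ψ₂, IsGroundStateInSector (hamiltonian (fermionTorusGraph 1 L) t U) (2 * n) 0 ψ₁ →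
          IsGroundStateInSector (hamiltonian (fermionTorusGraph 1 L) t U) (2 * n) 0 ψ₂ →
          ∃ c : ℂ, ψ₂ = c • ψ₁) ∧
        ∀ ψ, IsGroundStateInSector (hamiltonian (fermionTorusGraph 1 L) t U) (2 * n) 0 ψ →
          ∃ c : ℂ, c ≠ 0 ∧ ∀ α β : Config (FermionTorus 1 L) n,
            0 < (c * liebW n ψ α β).re ∧ (c * liebW n ψ α β).im = 0 := by
  have hcard : n ≤ Fintype.card (FermionTorus 1 L) := by
    simpa [FermionTorus, Fintype.card_lex] using hnL
  obtain ⟨hex, hb⟩ := szSector_groundState (fermionTorusGraph 1 L) t U hcard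
  obtain ⟨huniq, hpos⟩ := liebWu_sector_groundState_ring L ht U hn hb
  refine ⟨hex, fun ψ₁ ψ₂ h₁ h₂ => ?_, fun ψ h => ?_⟩
  · exact huniq ψ₁ ψ₂ ((mem_szSector_two_mul_zero_iff n ψ₁).1 h₁.1)
      ((mem_szSector_two_mul_zero_iff n ψ₂).1 h₂.1) h₁.2.2 h₂.2.2 h₁.2.1
  · exact hpos ψ ((mem_szSector_two_mul_zero_iff n ψ).1 h.1) h.2.2 h.2.1

end Ring

end Literature.MathematicalPhysics.QuantumLattice
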